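import Literature.MathematicalPhysics.QuantumFieldTheory.ConstructiveQFTBalabanRG
import HarnessLib

/-!
# Status of `BlockRGScheme.HasUniformUVStability` (and its `AE` / `IsRGIterate` companions): predicates on schemes, not closed facts

Sibling proof file of
`Literature/MathematicalPhysics/QuantumFieldTheory/ConstructiveQFTBalabanRG.lean`
(constructive-qft.S20, Bałaban's ultraviolet stability, schematic over the hypothesis structure
`Literature.MathematicalPhysics.QuantumLattice.BlockRGScheme` of prelude A18). No definition or
statement is introduced; only elementary theorems are proved.

The declaration
`Literature.MathematicalPhysics.QuantumLattice.BlockRGScheme.HasUniformUVStability` is written in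
the statements file with body `∃ c C, ∀ k, sch.HasUVStabilityBounds c C k` under the section
variable `(sch : BlockRGScheme d N G)`, so its type is `BlockRGScheme d N G → Prop`: it is a
*property of a scheme* (the single-scheme shape of Bałaban, CMP 102 (1985) Thm. 1, "API only" in
the words of its docstring), not a closed proposition admitting a discharge
`HasUniformUVStability_holds : HasUniformUVStability`. This file records the two theorems that
pin this down inside Lean:

* `BlockRGScheme.exists_hasUniformUVStability` — the predicate is satisfiable: the scheme with
  the trivial representation `ρ = 1` (whose Wilson action vanishes identically, so that the
  Wilson starting density is the constant `1`) and all effective densities equal to `1` is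
  uniformly UV stable with constants `c = C = 0`;
* `BlockRGScheme.not_forall_hasUniformUVStability` — its universal closure fails: the v0
  structure `BlockRGScheme` constrains only the starting density (`effDensity_zero`; the RG
  recursion is the documented `STUB(v0)` of A18), so the data `M, ρ, couplings, effDensity 0` of
  ANY scheme can be continued by the zero density from step `1` on
  (`BlockRGScheme.exists_not_hasUVStability_one`), and the zero density violates the lower bound
  `e^{-c|Λ|} ≤ ρ_1(Λ, V)` already for `Λ = ∅` (`BlockRGScheme.not_hasUVStability_of_effDensity_nonpos`).

Consequently neither `∀ sch, sch.HasUniformUVStability` nor its negation `∀ sch, ¬ …` is a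
theorem: the truth value depends on the scheme, exactly as for the neighbouring predicates
`HasUVStability k`, `HasWindowedUVStability γ`, `HasUniformUVStabilityAE`, `IsRGIterate(With)`.
The non-trivial mathematics attached to the name in the statements file — `k`-uniform bounds
on the log-oscillation of the *normalised block RG iterates* of one fixed scheme by Haar
invariance (review r02500B), and Bałaban's uniformity in the cutoff (`BalabanUVStability3/4`) —
concerns schemes satisfying the recursion `IsRGIterateWith E`, and is not formalised here.

## The almost-everywhere form `HasUniformUVStabilityAE`

The same holds for the a.e. companion
`Literature.MathematicalPhysics.QuantumLattice.BlockRGScheme.HasUniformUVStabilityAE`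
(`∃ c C, ∀ k, sch.HasUVStabilityBoundsAE c C k`, bounds `freeHaarConfig Λ`-a.e. in the coarse
field), again a predicate under the section variable `sch`:

* `isProbabilityMeasure_freeHaarConfig` — the free-boundary reference measure
  `freeHaarConfig Λ` (product Haar probability measures glued with `1` off `Λ`,
  `measurable_glueWith`) is a probability measure, so an a.e. statement over it is not vacuous;
* `BlockRGScheme.not_hasUVStabilityBoundsAtAE_of_forall_effDensity_nonpos` — a density that is
  everywhere `≤ 0` at step `k` violates the a.e. bounds at step `k` (at `Λ = ∅` the lower bound
  reads `1 ≤ ρ_k(∅, V)` for a.e. `V` of a probability space);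
* `BlockRGScheme.exists_not_hasUniformUVStabilityAE` — the zero continuation from step `1` of
  any scheme is not uniformly a.e. UV stable; `BlockRGScheme.exists_hasUniformUVStabilityAE` —
  the predicate is satisfiable (pointwise bounds imply a.e. bounds, `HasUniformUVStability.ae`);
  hence `BlockRGScheme.not_forall_hasUniformUVStabilityAE`: `¬ ∀ sch, sch.HasUniformUVStabilityAE`,
  and no discharge `HasUniformUVStabilityAE_holds` exists either.

## The block RG recursion predicates `IsRGIterateWith E`, `IsRGIterate`

Likewise `Literature.MathematicalPhysics.QuantumLattice.BlockRGScheme.IsRGIterateWith E` and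
`BlockRGScheme.IsRGIterate` (`= IsRGIterateWith 0`) are predicates under the section variable
`sch` (the normalised / unnormalised free-boundary block RG recursion, Bałaban CMP 109 (1987)
(0.1)–(0.3), imposed as a hypothesis in `BalabanUVStability3/4`), and their universal closures
fail:

* `wilsonBoundaryAction_one` — in the trivial representation the boundary Wilson action
  vanishes, so the Wilson starting density is the constant `1`;
* `measure_map_univ_le` — total mass does not increase under `Measure.map` (preserved for an
  a.e.-measurable map, zero measure otherwise), so no measurability of the block holonomy map
  `axialBlockHolonomy M` is needed below;
* `BlockRGScheme.exists_not_isRGIterateWith` — for every choice of normalisations `E`, the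
  scheme with trivial representation and later densities `ρ_{k+1}(Λ, V) = 2 e^{E_k(Λ)}` is not
  a normalised block RG iterate: step `0 → 1` at `Λ = ∅` would equate a push-forward of the
  probability measure `freeHaarConfig (fineEdges M ∅)` (total mass `≤ 1`) with
  `2 · freeHaarConfig ∅` (total mass `2`); `BlockRGScheme.exists_not_isRGIterate` is the case
  `E = 0` (`isRGIterateWith_zero_iff`).

History. The closed witnesses `exists_not_isRGIterateWith`, `exists_not_isRGIterate`,
`exists_not_hasUniformUVStability`, `exists_not_hasUniformUVStabilityAE` (`∃ sch, ¬ …`) were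
first landed by proposal p27930; a concurrent whole-file proposal (p27937, written before p27930
was visible) replaced that file, and p28161 extended p27937. The present version restores the
two `IsRGIterate(With)` statements of p27930 with their names and types; the closed forms of the
two stability statements of p27930 are the (equivalent) `not_forall_hasUniformUVStability(AE)`,
while the names `exists_not_hasUniformUVStability(AE)` now carry the stronger relative form
(same block size, representation, couplings and starting density as any given scheme).

## References

* T. Bałaban, *Ultraviolet stability of three-dimensional lattice pure gauge field theories*,
  Comm. Math. Phys. 102 (1985) 255–275, Thm. 1 (the shape `e^{-c|Λ|} ≤ ρ_k ≤ e^{C|Λ|}`).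
* T. Bałaban, *Renormalization group approach to lattice gauge field theories. I*, Comm. Math.
  Phys. 109 (1987) 249–301, (0.1)–(0.3) (the recursion the v0 structure does not impose).
-/

open Literature.MathematicalPhysics.QuantumLattice Literature.Probability.LatticeModels

namespace Literature.MathematicalPhysics.QuantumFieldTheory

variable {d N : ℕ} {G : Type*} [Group G] [MeasurableSpace G]

/-- A scheme one of whose effective densities takes a non-positive value at some step `j ≤ k`
is not UV stable up to step `k` (the lower stability bound `e^{-c|Λ|} ≤ ρ_j(Λ, V)` is a positive
number; contrapositive of `BlockRGScheme.HasUVStabilityBounds.effDensity_pos`). [folklore] -/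
theorem _root_.Literature.MathematicalPhysics.QuantumLattice.BlockRGScheme.not_hasUVStability_of_effDensity_nonpos
    (sch : BlockRGScheme d N G) {k j : ℕ} (hj : j ≤ k) {Λ : Finset (ZdEdge d)} {V : LGConfig d G}
    (h : sch.effDensity j Λ V ≤ 0) : ¬ sch.HasUVStability k := fun ⟨_, _, hcC⟩ =>
  not_lt.2 h (hcC.effDensity_pos sch hj Λ V)

/-- **The v0 structure does not force UV stability beyond step `0`.** For every block RG scheme
`sch` there is a scheme with the same block size, representation, running couplings and (Wilson)
starting density whose effective densities vanish from step `1` on; it is not UV stable up to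
step `1` (for any constants). The RG recursion linking `effDensity (k+1)` to `effDensity k`
(Bałaban CMP 109 (1987) (0.1)–(0.3)) is the documented `STUB(v0)` of
`BlockRGScheme.effDensity`, so nothing in the structure excludes this continuation. [folklore] -/
theorem _root_.Literature.MathematicalPhysics.QuantumLattice.BlockRGScheme.exists_not_hasUVStability_one
    (sch : BlockRGScheme d N G) :
    ∃ sch' : BlockRGScheme d N G, sch'.M = sch.M ∧ sch'.ρ = sch.ρ ∧
      sch'.couplings = sch.couplings ∧ sch'.effDensity 0 = sch.effDensity 0 ∧
      ¬ sch'.HasUVStability 1 := by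
  refine ⟨⟨sch.M, sch.two_le_M, sch.ρ, sch.couplings,
      fun k Λ U => if k = 0 then sch.effDensity 0 Λ U else 0,
      fun Λ U => by simp [sch.effDensity_zero]⟩,
    rfl, rfl, rfl, ?_, ?_⟩
  · funext Λ U
    simp
  · refine BlockRGScheme.not_hasUVStability_of_effDensity_nonpos _ (le_refl 1) (Λ := ∅)
      (V := 1) ?_
    simp

/-- The same continuation violates *uniform* UV stability: for every scheme there is one with
the same block size, representation, running couplings and starting density that is not
uniformly UV stable. [folklore] -/
theorem _root_.Literature.MathematicalPhysics.QuantumLattice.BlockRGScheme.exists_not_hasUniformUVStability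
    (sch : BlockRGScheme d N G) :
    ∃ sch' : BlockRGScheme d N G, sch'.M = sch.M ∧ sch'.ρ = sch.ρ ∧
      sch'.couplings = sch.couplings ∧ sch'.effDensity 0 = sch.effDensity 0 ∧
      ¬ sch'.HasUniformUVStability := by
  obtain ⟨sch', hM, hρ, hg, h0, h1⟩ := sch.exists_not_hasUVStability_one
  exact ⟨sch', hM, hρ, hg, h0, fun h => h1 (h.hasUVStability sch' 1)⟩

/-- **`HasUniformUVStability` is satisfiable.** The scheme with block size `2`, the trivial
representation `ρ = 1 : G →* M_N(ℂ)` (every plaquette observable equals `Re tr 1 = N`, so the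
boundary Wilson action vanishes identically and the Wilson starting density is the constant
`1`), zero couplings and all effective densities equal to `1` is uniformly UV stable with
constants `c = C = 0`. [folklore] -/
theorem _root_.Literature.MathematicalPhysics.QuantumLattice.BlockRGScheme.exists_hasUniformUVStability :
    ∃ sch : BlockRGScheme d N G, sch.HasUniformUVStability := by
  have hS : ∀ (Λ : Finset (ZdEdge d)) (U : LGConfig d G),
      wilsonBoundaryAction (1 : G →* Matrix (Fin N) (Fin N) ℂ) Λ U = 0 := fun Λ U =>
    Finset.sum_eq_zero fun p _ => by
      simp [plaquetteObs, Matrix.trace_one, Fintype.card_fin]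
  refine ⟨⟨2, le_rfl, 1, 0, fun _ _ _ => 1,
      fun Λ U => by rw [hS, mul_zero, neg_zero, Real.exp_zero]⟩,
    0, 0, fun j _ Λ V => ?_⟩
  simp

/-- **The universal closure of `HasUniformUVStability` fails**: not every block RG scheme is
uniformly UV stable (apply `exists_not_hasUniformUVStability` to the scheme of
`exists_hasUniformUVStability`). Together with `exists_hasUniformUVStability` this shows that
`BlockRGScheme.HasUniformUVStability` is a genuine hypothesis on the scheme — the single-scheme
*shape* of Bałaban CMP 102 (1985) Thm. 1 — and not a closed proposition admitting a discharge
`HasUniformUVStability_holds`. [folklore] -/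
theorem _root_.Literature.MathematicalPhysics.QuantumLattice.BlockRGScheme.not_forall_hasUniformUVStability :
    ¬ ∀ sch : BlockRGScheme d N G, sch.HasUniformUVStability := by
  intro h
  obtain ⟨sch₀, -⟩ := BlockRGScheme.exists_hasUniformUVStability (d := d) (N := N) (G := G)
  obtain ⟨sch', -, -, -, -, h'⟩ := sch₀.exists_not_hasUniformUVStability
  exact h' (h sch')


/-! ### The almost-everywhere form `HasUniformUVStabilityAE` -/

section AE

open MeasureTheory Filter

variable [TopologicalSpace G] [IsTopologicalGroup G] [CompactSpace G] [BorelSpace G]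

/-- The free-boundary reference measure `freeHaarConfig Λ` is a probability measure (product of
Haar probability measures pushed forward along the measurable gluing map
`measurable_glueWith`). [folklore] -/
theorem _root_.Literature.MathematicalPhysics.QuantumLattice.isProbabilityMeasure_freeHaarConfig
    (Λ : Finset (ZdEdge d)) : IsProbabilityMeasure (freeHaarConfig (G := G) Λ) :=
  Measure.isProbabilityMeasure_map (measurable_glueWith Λ (1 : LGConfig d G)).aemeasurable

/-- A scheme whose effective density at step `k` is everywhere non-positive violates the a.e.
UV stability bounds at step `k`, for any constants: at `Λ = ∅` the a.e. lower bound reads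
`1 ≤ ρ_k(∅, V)` for `freeHaarConfig ∅`-a.e. `V`, and `freeHaarConfig ∅` is a probability
measure. [folklore] -/
theorem _root_.Literature.MathematicalPhysics.QuantumLattice.BlockRGScheme.not_hasUVStabilityBoundsAtAE_of_forall_effDensity_nonpos
    (sch : BlockRGScheme d N G) {c C : ℝ} {k : ℕ}
    (h : ∀ V : LGConfig d G, sch.effDensity k ∅ V ≤ 0) : ¬ sch.HasUVStabilityBoundsAtAE c C k := by
  intro hb
  have h2 : ∀ᵐ _V ∂(freeHaarConfig (∅ : Finset (ZdEdge d)) : Measure (LGConfig d G)), False :=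
    (hb ∅).mono fun V hV => not_le.2 (Real.exp_pos _) (hV.1.trans (h V))
  rw [eventually_false_iff_eq_bot, ae_eq_bot] at h2
  haveI := isProbabilityMeasure_freeHaarConfig (d := d) (G := G) ∅
  exact IsProbabilityMeasure.ne_zero (freeHaarConfig (G := G) (∅ : Finset (ZdEdge d))) h2

/-- **The v0 structure does not force a.e. UV stability beyond step `0`.** For every block RG
scheme there is one with the same block size, representation, running couplings and (Wilson)
starting density — its effective densities vanish from step `1` on — that is not uniformly
a.e. UV stable (the a.e. analogue of `BlockRGScheme.exists_not_hasUniformUVStability`). [folklore] -/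
theorem _root_.Literature.MathematicalPhysics.QuantumLattice.BlockRGScheme.exists_not_hasUniformUVStabilityAE
    (sch : BlockRGScheme d N G) :
    ∃ sch' : BlockRGScheme d N G, sch'.M = sch.M ∧ sch'.ρ = sch.ρ ∧
      sch'.couplings = sch.couplings ∧ sch'.effDensity 0 = sch.effDensity 0 ∧
      ¬ sch'.HasUniformUVStabilityAE := by
  refine ⟨⟨sch.M, sch.two_le_M, sch.ρ, sch.couplings,
      fun k Λ U => if k = 0 then sch.effDensity 0 Λ U else 0,
      fun Λ U => by simp [sch.effDensity_zero]⟩,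
    rfl, rfl, rfl, ?_, ?_⟩
  · funext Λ U
    simp
  · rintro ⟨c, C, hcC⟩
    exact BlockRGScheme.not_hasUVStabilityBoundsAtAE_of_forall_effDensity_nonpos _
      (fun V => by simp) ((hcC 1).at _)

/-- **`HasUniformUVStabilityAE` is satisfiable**: the uniformly UV stable scheme of
`BlockRGScheme.exists_hasUniformUVStability` is uniformly a.e. UV stable (pointwise bounds imply
a.e. bounds, `HasUniformUVStability.ae`). [folklore] -/
theorem _root_.Literature.MathematicalPhysics.QuantumLattice.BlockRGScheme.exists_hasUniformUVStabilityAE :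
    ∃ sch : BlockRGScheme d N G, sch.HasUniformUVStabilityAE := by
  obtain ⟨sch, h⟩ := BlockRGScheme.exists_hasUniformUVStability (d := d) (N := N) (G := G)
  exact ⟨sch, h.ae sch⟩

/-- **The universal closure of `HasUniformUVStabilityAE` fails**: not every block RG scheme is
uniformly a.e. UV stable. Together with `exists_hasUniformUVStabilityAE` this shows that
`BlockRGScheme.HasUniformUVStabilityAE` is a genuine hypothesis on the scheme (the single-scheme
a.e. *shape* of Bałaban CMP 102 (1985) Thm. 1) and not a closed proposition admitting a discharge
`HasUniformUVStabilityAE_holds`; the elementary positive statement of its docstring (review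
r02500B) concerns schemes whose densities are the normalised block RG iterates
(`IsRGIterateWith E`). [folklore] -/
theorem _root_.Literature.MathematicalPhysics.QuantumLattice.BlockRGScheme.not_forall_hasUniformUVStabilityAE :
    ¬ ∀ sch : BlockRGScheme d N G, sch.HasUniformUVStabilityAE := by
  intro h
  obtain ⟨sch₀, -⟩ := BlockRGScheme.exists_hasUniformUVStabilityAE (d := d) (N := N) (G := G)
  obtain ⟨sch', -, -, -, -, h'⟩ := sch₀.exists_not_hasUniformUVStabilityAE
  exact h' (h sch')

end AE

/-! ### The block RG recursion predicates `IsRGIterateWith E`, `IsRGIterate` -/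

section Recursion

open MeasureTheory

omit [MeasurableSpace G] in
/-- In the trivial representation `ρ = 1 : G →* M_N(ℂ)` every plaquette observable equals
`Re tr 1 = N`, so the boundary Wilson action `S_Λ(U) = ∑_p (N - Re tr ρ(U_p))` vanishes
identically. [folklore] -/
theorem _root_.Literature.MathematicalPhysics.QuantumLattice.wilsonBoundaryAction_one
    (Λ : Finset (ZdEdge d)) (U : LGConfig d G) :
    wilsonBoundaryAction (1 : G →* Matrix (Fin N) (Fin N) ℂ) Λ U = 0 :=
  Finset.sum_eq_zero fun p _ => by simp [plaquetteObs, Matrix.trace_one, Fintype.card_fin]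

/-- Total mass does not increase under push-forward of a measure (it is preserved when the map
is a.e.-measurable, and `Measure.map` is the zero measure otherwise). [folklore] -/
theorem measure_map_univ_le {α β : Type*} [MeasurableSpace α] [MeasurableSpace β]
    (μ : Measure α) (f : α → β) : μ.map f Set.univ ≤ μ Set.univ := by
  by_cases hf : AEMeasurable f μ
  · rw [Measure.map_apply_of_aemeasurable hf MeasurableSet.univ, Set.preimage_univ]
  · simp [Measure.map_of_not_aemeasurable hf]

variable [TopologicalSpace G] [IsTopologicalGroup G] [CompactSpace G] [BorelSpace G]

/-- **For every choice of normalisations `E` some scheme is not a normalised block RG iterate**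
(the statement first landed by p27930). Witness: block size `2`, trivial representation (Wilson
starting density `1`, `wilsonBoundaryAction_one`), later densities `ρ_{k+1}(Λ, V) = 2 e^{E_k(Λ)}`.
Step `0 → 1` of `IsRGIterateWith E` at `Λ = ∅` would equate the push-forward under the block
holonomy map of the probability measure `freeHaarConfig (fineEdges 2 ∅)` with density `1`
(total mass `≤ 1`, `measure_map_univ_le` — no measurability of `axialBlockHolonomy` is used)
and `freeHaarConfig ∅` with density `e^{-E_0(∅)} · 2 e^{E_0(∅)} = 2` (total mass `2`,
`isProbabilityMeasure_freeHaarConfig`). [folklore] -/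
theorem _root_.Literature.MathematicalPhysics.QuantumLattice.BlockRGScheme.exists_not_isRGIterateWith
    (E : ℕ → Finset (ZdEdge d) → ℝ) :
    ∃ sch : BlockRGScheme d N G, ¬ sch.IsRGIterateWith E := by
  obtain ⟨sch, h0, h1⟩ : ∃ sch : BlockRGScheme d N G, (∀ Λ U, sch.effDensity 0 Λ U = 1) ∧
      ∀ Λ V, sch.effDensity 1 Λ V = 2 * Real.exp (E 0 Λ) :=
    ⟨⟨2, le_rfl, 1, 0, fun k Λ _ => if k = 0 then 1 else 2 * Real.exp (E (k - 1) Λ),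
        fun Λ U => by simp [wilsonBoundaryAction_one]⟩,
      fun Λ U => by simp, fun Λ V => by simp⟩
  refine ⟨sch, fun h => ?_⟩
  haveI := isProbabilityMeasure_freeHaarConfig (G := G) (fineEdges sch.M (∅ : Finset (ZdEdge d)))
  haveI := isProbabilityMeasure_freeHaarConfig (G := G) (∅ : Finset (ZdEdge d))
  have h2 : Real.exp (-E 0 ∅) * (2 * Real.exp (E 0 ∅)) = 2 := by
    rw [Real.exp_neg, mul_left_comm, inv_mul_cancel₀ (Real.exp_ne_zero _), mul_one]
  have key := congrArg (fun m : Measure (LGConfig d G) => m Set.univ) (h 0 ∅)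
  simp only [h0, h1, h2, zero_add, ENNReal.ofReal_one, ENNReal.ofReal_ofNat, withDensity_const,
    one_smul, Measure.smul_apply, smul_eq_mul, measure_univ, mul_one] at key
  have hle := measure_map_univ_le (freeHaarConfig (G := G) (fineEdges sch.M (∅ : Finset (ZdEdge d))))
    (axialBlockHolonomy sch.M)
  rw [key, measure_univ] at hle
  exact absurd hle (by norm_num)

/-- **Some scheme is not an (unnormalised) block RG iterate** (the statement first landed by
p27930): the case `E = 0` of `exists_not_isRGIterateWith`, via `isRGIterateWith_zero_iff`. [folklore] -/
theorem _root_.Literature.MathematicalPhysics.QuantumLattice.BlockRGScheme.exists_not_isRGIterate :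
    ∃ sch : BlockRGScheme d N G, ¬ sch.IsRGIterate := by
  obtain ⟨sch, h⟩ :=
    BlockRGScheme.exists_not_isRGIterateWith (N := N) (G := G) (0 : ℕ → Finset (ZdEdge d) → ℝ)
  exact ⟨sch, fun h' => h ((BlockRGScheme.isRGIterateWith_zero_iff sch).2 h')⟩

end Recursion

end Literature.MathematicalPhysics.QuantumFieldTheory
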